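import Literature.Analysis.FluidPDE.Vorticity
import Literature.Analysis.FluidPDE.SingularKernelTruncation
import HarnessLib

/-!
# The smooth high/low splitting of a vector field at a magnitude threshold

Analysis/FluidPDE proof file (theorems only; no definitions), a brick of the discharge of
`Literature.Analysis.FluidPDE.constantin_fefferman` (`NSVorticity.lean`). Constantin–Fefferman
(Indiana Univ. Math. J. 42 (1993), §2) and Lemarié-Rieusset (2016, proof of Thm. 11.7:
"`ω = α + β`, `α = 1_{|ω| ≤ R} ω`") split the vorticity into the part where `|ω| ≤ R` and the part
where `|ω| > R`. We use the **smooth** version of this splitting, with the tree's radial cutoff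
`θ = radialCutoff R (2R)` (`= 1` on `|z| ≤ R`, `= 0` on `|z| ≥ 2R`, `0 ≤ θ ≤ 1`,
`‖∇θ‖ ≤ B/R`) evaluated **at the value** `w(y)`:

  `w_lo(y) = θ(w y) • w y`,   `w_hi(y) = (1 − θ(w y)) • w y`,

so that `w = w_lo + w_hi` (Mathlib's `smul_add_one_sub_smul`), `|w_lo| ≤ min(|w|, 2R)`,
`|w_hi| ≤ |w|`, `w_hi(y) ≠ 0 ⇒ |w(y)| > R`, `w_hi(y)` is a nonnegative multiple of the direction
`w(y)/|w(y)|`, `w_hi` is `C¹` with `‖∇w_hi‖ ≤ (1 + 2B)‖∇w‖` pointwise, and `w_hi` has compact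
support as soon as `w → 0` at infinity. The smooth splitting keeps every field classical (no
indicator functions), which is what
lets the stretching term be integrated by parts and represented by the Biot–Savart gradient formula
in `ConstantinFeffermanStretching.lean`. Also recorded: the elementary geometry of the component of
a vector orthogonal to a unit vector, `‖v − ⟪v,e⟫e‖² = ‖v‖² − ⟪v,e⟫²`, i.e.
`‖v − ⟪v,e⟫e‖ = |v| √(1 − ⟪v/|v|, e⟫²)` — Constantin–Fefferman's `|sin φ|`.

## References

* P. Constantin, C. Fefferman, Indiana Univ. Math. J. 42 (1993), 775–789, §2.
  [ConstantinFeffermanIndiana1993]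
* P. G. Lemarié-Rieusset, *The Navier–Stokes Problem in the 21st Century* (2016), Thm. 11.7,
  proof (PDF p. 370, the splitting `ω = α + β`). [LemarieRieusset2016]
-/

noncomputable section

open MeasureTheory Set Function Filter Metric Real InnerProductSpace
open _root_.Topology
open scoped ENNReal NNReal RealInnerProductSpace

namespace Literature.Analysis.FluidPDE

/-! ### Geometry of the orthogonal component -/

/-- `‖v − ⟪v, e⟫ e‖² = ‖v‖² − ⟪v, e⟫²` for a unit vector `e`. [folklore] -/
theorem norm_sub_inner_smul_sq {e : (EuclideanSpace ℝ (Fin 3))} (he : ‖e‖ = 1) (v : (EuclideanSpace ℝ (Fin 3))) :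
    ‖v - ⟪v, e⟫ • e‖ ^ 2 = ‖v‖ ^ 2 - ⟪v, e⟫ ^ 2 := by
  rw [@norm_sub_sq_real, norm_smul, he, mul_one, Real.norm_eq_abs, sq_abs, real_inner_smul_right]
  ring

/-- `‖v − ⟪v, e⟫ e‖ ≤ ‖v‖` for a unit vector `e`. [folklore] -/
theorem norm_sub_inner_smul_le {e : (EuclideanSpace ℝ (Fin 3))} (he : ‖e‖ = 1) (v : (EuclideanSpace ℝ (Fin 3))) : ‖v - ⟪v, e⟫ • e‖ ≤ ‖v‖ := by
  have h := norm_sub_inner_smul_sq he v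
  nlinarith [norm_nonneg (v - ⟪v, e⟫ • e), norm_nonneg v, sq_nonneg ⟪v, e⟫]

/-- **The orthogonal component as `|v| |sin φ|`**: for a unit vector `e` and `v ≠ 0`,
`‖v − ⟪v, e⟫ e‖ = ‖v‖ √(1 − ⟪v/‖v‖, e⟫²)` (Constantin–Fefferman's `|sin φ|`, `φ` the angle
between the directions of `v` and `e`). [cite: ConstantinFeffermanIndiana1993, §1 (the quantity |sin φ|)] -/
theorem norm_sub_inner_smul_eq_norm_mul_sqrt {e : (EuclideanSpace ℝ (Fin 3))} (he : ‖e‖ = 1) {v : (EuclideanSpace ℝ (Fin 3))} (hv : v ≠ 0) :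
    ‖v - ⟪v, e⟫ • e‖ = ‖v‖ * Real.sqrt (1 - ⟪‖v‖⁻¹ • v, e⟫ ^ 2) := by
  have hvn : 0 < ‖v‖ := norm_pos_iff.2 hv
  have hsq : ‖v - ⟪v, e⟫ • e‖ ^ 2 = (‖v‖ * Real.sqrt (1 - ⟪‖v‖⁻¹ • v, e⟫ ^ 2)) ^ 2 := by
    have h1 : 0 ≤ 1 - ⟪‖v‖⁻¹ • v, e⟫ ^ 2 := by
      have hc : |⟪‖v‖⁻¹ • v, e⟫| ≤ 1 := by
        calc |⟪‖v‖⁻¹ • v, e⟫| ≤ ‖‖v‖⁻¹ • v‖ * ‖e‖ := abs_real_inner_le_norm _ _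
          _ = 1 := by rw [norm_smul, norm_inv, norm_norm, inv_mul_cancel₀ hvn.ne', he, mul_one]
      nlinarith [abs_nonneg ⟪‖v‖⁻¹ • v, e⟫, sq_abs ⟪‖v‖⁻¹ • v, e⟫]
    rw [mul_pow, Real.sq_sqrt h1, norm_sub_inner_smul_sq he, real_inner_smul_left]
    field_simp
  have ha : 0 ≤ ‖v - ⟪v, e⟫ • e‖ := norm_nonneg _
  have hb : 0 ≤ ‖v‖ * Real.sqrt (1 - ⟪‖v‖⁻¹ • v, e⟫ ^ 2) := by positivity
  nlinarith [hsq, ha, hb, sq_nonneg (‖v - ⟪v, e⟫ • e‖ - ‖v‖ * Real.sqrt (1 - ⟪‖v‖⁻¹ • v, e⟫ ^ 2))]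

/-- `√(1 − t²)`-type factors are at most one: `‖v − ⟪v,e⟫e‖ ≤ ‖v‖ · min 1 s` whenever
`√(1 − ⟪v/‖v‖, e⟫²) ≤ s` (`e` unit, `v ≠ 0`). [folklore] -/
theorem norm_sub_inner_smul_le_mul_min {e : (EuclideanSpace ℝ (Fin 3))} (he : ‖e‖ = 1) {v : (EuclideanSpace ℝ (Fin 3))} (hv : v ≠ 0) {s : ℝ}
    (hs : Real.sqrt (1 - ⟪‖v‖⁻¹ • v, e⟫ ^ 2) ≤ s) : ‖v - ⟪v, e⟫ • e‖ ≤ ‖v‖ * min 1 s := by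
  rcases le_total 1 s with h1 | h1
  · rw [min_eq_left h1, mul_one]
    exact norm_sub_inner_smul_le he v
  · rw [min_eq_right h1, norm_sub_inner_smul_eq_norm_mul_sqrt he hv]
    exact mul_le_mul_of_nonneg_left hs (norm_nonneg _)

/-! ### The splitting -/

section Splitting

variable {w : (EuclideanSpace ℝ (Fin 3)) → (EuclideanSpace ℝ (Fin 3))} {R : ℝ}

/-- `‖w_lo(y)‖ ≤ ‖w(y)‖`. [folklore] -/
theorem norm_lowPart_le_norm (w : (EuclideanSpace ℝ (Fin 3)) → (EuclideanSpace ℝ (Fin 3))) (R : ℝ) (y : (EuclideanSpace ℝ (Fin 3))) :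
    ‖radialCutoff R (2 * R) (w y) • w y‖ ≤ ‖w y‖ := by
  rw [norm_smul, Real.norm_eq_abs, abs_of_nonneg (radialCutoff_nonneg _ _ _)]
  exact mul_le_of_le_one_left (norm_nonneg _) (radialCutoff_le_one _ _ _)

/-- **`‖w_lo(y)‖ ≤ 2R`** (`R > 0`): the cutoff vanishes where `|w| ≥ 2R`. [folklore] -/
theorem norm_lowPart_le (hR : 0 < R) (y : (EuclideanSpace ℝ (Fin 3))) :
    ‖radialCutoff R (2 * R) (w y) • w y‖ ≤ 2 * R := by
  rcases le_or_gt (2 * R) ‖w y‖ with h | h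
  · rw [radialCutoff_eq_zero hR.le (by linarith) h, zero_smul, norm_zero]
    positivity
  · exact (norm_lowPart_le_norm w R y).trans h.le

/-- `‖w_hi(y)‖ ≤ ‖w(y)‖`. [folklore] -/
theorem norm_highPart_le_norm (w : (EuclideanSpace ℝ (Fin 3)) → (EuclideanSpace ℝ (Fin 3))) (R : ℝ) (y : (EuclideanSpace ℝ (Fin 3))) :
    ‖(1 - radialCutoff R (2 * R) (w y)) • w y‖ ≤ ‖w y‖ := by
  rw [norm_smul, Real.norm_eq_abs, abs_of_nonneg (sub_nonneg.2 (radialCutoff_le_one _ _ _))]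
  exact mul_le_of_le_one_left (norm_nonneg _) (sub_le_self _ (radialCutoff_nonneg _ _ _))

/-- **`w_hi(y) ≠ 0 ⇒ |w(y)| > R`** (`R > 0`): the high part lives in the region of high
magnitude. [cite: LemarieRieusset2016, Thm. 11.7 (proof, the splitting ω = α + β)] -/
theorem lt_norm_of_highPart_ne_zero (hR : 0 < R) {y : (EuclideanSpace ℝ (Fin 3))}
    (hy : (1 - radialCutoff R (2 * R) (w y)) • w y ≠ 0) : R < ‖w y‖ := by
  by_contra h
  rw [radialCutoff_eq_one hR.le (by linarith) (not_lt.1 h), sub_self, zero_smul] at hy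
  exact hy rfl

/-- `w_hi = 0` where `|w| ≤ R`. [folklore] -/
theorem highPart_eq_zero_of_norm_le (hR : 0 < R) {y : (EuclideanSpace ℝ (Fin 3))} (hy : ‖w y‖ ≤ R) :
    (1 - radialCutoff R (2 * R) (w y)) • w y = 0 := by
  rw [radialCutoff_eq_one hR.le (by linarith) hy, sub_self, zero_smul]

/-- **The high part is parallel to the direction field**: `w_hi(y) = c • ξ(y)`,
`ξ = w/|w|` (`vorticityDirection w`), with `c = (1 − θ(w y))‖w y‖ ≥ 0`. [folklore] -/
theorem highPart_eq_smul_vorticityDirection (w : (EuclideanSpace ℝ (Fin 3)) → (EuclideanSpace ℝ (Fin 3))) (R : ℝ) (y : (EuclideanSpace ℝ (Fin 3))) :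
    (1 - radialCutoff R (2 * R) (w y)) • w y =
      ((1 - radialCutoff R (2 * R) (w y)) * ‖w y‖) • vorticityDirection w y := by
  rw [vorticityDirection_apply, smul_smul]
  by_cases h : w y = 0
  · simp [h]
  · rw [mul_assoc, mul_inv_cancel₀ (norm_ne_zero_iff.2 h), mul_one]

/-- The orthogonal component of the high part: `‖w_hi(y) − ⟪w_hi(y), e⟫e‖ =
(1 − θ(w y)) ‖w(y) − ⟪w(y), e⟫e‖`. [folklore] -/
theorem norm_highPart_sub_inner_smul (w : (EuclideanSpace ℝ (Fin 3)) → (EuclideanSpace ℝ (Fin 3))) (R : ℝ) (y e : (EuclideanSpace ℝ (Fin 3))) :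
    ‖(1 - radialCutoff R (2 * R) (w y)) • w y -
        ⟪(1 - radialCutoff R (2 * R) (w y)) • w y, e⟫ • e‖ =
      (1 - radialCutoff R (2 * R) (w y)) * ‖w y - ⟪w y, e⟫ • e‖ := by
  have h0 : 0 ≤ 1 - radialCutoff R (2 * R) (w y) := sub_nonneg.2 (radialCutoff_le_one _ _ _)
  rw [real_inner_smul_left, mul_smul, ← smul_sub, norm_smul, Real.norm_eq_abs, abs_of_nonneg h0]

/-- **The depleted majorant for the high part under the Constantin–Fefferman hypothesis.**
Let `e = ξ(x)` be the (unit) direction at a point `x`, and assume `√(1 − ⟪ξ(x), ξ(y)⟫²) ≤ s`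
whenever `|w(y)| > R` (the direction hypothesis at the pair `(x, y)`, `s = |x − y|/ρ`). Then
`‖w_hi(y) − ⟪w_hi(y), e⟫e‖ ≤ ‖w_hi(y)‖ · min 1 s`. [cite: ConstantinFeffermanIndiana1993, Theorem (§1), hypothesis |sin φ| ≤ |x−y|/ρ] -/
theorem norm_highPart_sub_inner_smul_le (hR : 0 < R) {e : (EuclideanSpace ℝ (Fin 3))} (he : ‖e‖ = 1) {y : (EuclideanSpace ℝ (Fin 3))} {s : ℝ}
    (hdir : R < ‖w y‖ → Real.sqrt (1 - ⟪e, vorticityDirection w y⟫ ^ 2) ≤ s) :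
    ‖(1 - radialCutoff R (2 * R) (w y)) • w y -
        ⟪(1 - radialCutoff R (2 * R) (w y)) • w y, e⟫ • e‖ ≤
      ‖(1 - radialCutoff R (2 * R) (w y)) • w y‖ * min 1 s := by
  by_cases hhi : (1 - radialCutoff R (2 * R) (w y)) • w y = 0
  · rw [hhi, inner_zero_left, zero_smul, sub_zero, norm_zero, zero_mul]
  have hwR : R < ‖w y‖ := lt_norm_of_highPart_ne_zero hR hhi
  have hw0 : w y ≠ 0 := by
    intro h; rw [h, norm_zero] at hwR; exact (lt_irrefl _ (hR.trans hwR))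
  have h0 : 0 ≤ 1 - radialCutoff R (2 * R) (w y) := sub_nonneg.2 (radialCutoff_le_one _ _ _)
  have hs : Real.sqrt (1 - ⟪‖w y‖⁻¹ • w y, e⟫ ^ 2) ≤ s := by
    have := hdir hwR
    rwa [vorticityDirection_apply, real_inner_comm] at this
  rw [norm_highPart_sub_inner_smul, norm_smul, Real.norm_eq_abs, abs_of_nonneg h0, mul_assoc]
  exact mul_le_mul_of_nonneg_left (norm_sub_inner_smul_le_mul_min he hw0 hs) h0

/-! ### Smoothness and the derivative bound -/

/-- The cutoff factor `y ↦ θ(w y)` is `C¹` for `C¹` fields. [folklore] -/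
theorem contDiff_radialCutoff_comp (hw : ContDiff ℝ 1 w) (R : ℝ) :
    ContDiff ℝ 1 fun y => radialCutoff R (2 * R) (w y) :=
  (radialCutoff_contDiff (E' := (EuclideanSpace ℝ (Fin 3))) R (2 * R) (n := 1)).comp hw

/-- `w_lo` is `C¹`. [folklore] -/
theorem contDiff_lowPart (hw : ContDiff ℝ 1 w) (R : ℝ) :
    ContDiff ℝ 1 fun y => radialCutoff R (2 * R) (w y) • w y :=
  (contDiff_radialCutoff_comp hw R).smul hw

/-- `w_hi` is `C¹`. [folklore] -/
theorem contDiff_highPart (hw : ContDiff ℝ 1 w) (R : ℝ) :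
    ContDiff ℝ 1 fun y => (1 - radialCutoff R (2 * R) (w y)) • w y :=
  (contDiff_const.sub (contDiff_radialCutoff_comp hw R)).smul hw

/-- The scaled cutoff has vanishing derivative off the shell `R ≤ |z| ≤ 2R` — in particular
`‖∇θ(z)‖ ‖z‖ ≤ 2B` everywhere, with `B` the uniform constant of
`exists_norm_fderiv_radialCutoff_le`. [folklore] -/
theorem norm_fderiv_radialCutoff_mul_norm_le {B : ℝ} (hB0 : 0 ≤ B)
    (hB : ∀ ε : ℝ, 0 < ε → ∀ z : (EuclideanSpace ℝ (Fin 3)), ‖fderiv ℝ (radialCutoff ε (2 * ε)) z‖ ≤ B * ε⁻¹)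
    (hR : 0 < R) (z : (EuclideanSpace ℝ (Fin 3))) : ‖fderiv ℝ (radialCutoff R (2 * R) : (EuclideanSpace ℝ (Fin 3)) → ℝ) z‖ * ‖z‖ ≤ 2 * B := by
  rcases lt_or_ge (2 * R) ‖z‖ with hz | hz
  · -- beyond `2R` the cutoff vanishes identically near `z`
    have hev : (radialCutoff R (2 * R) : (EuclideanSpace ℝ (Fin 3)) → ℝ) =ᶠ[𝓝 z] fun _ => 0 := by
      have hopen : IsOpen {y : (EuclideanSpace ℝ (Fin 3)) | 2 * R < ‖y‖} := isOpen_lt continuous_const continuous_norm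
      filter_upwards [hopen.mem_nhds hz] with y hy
      exact radialCutoff_eq_zero hR.le (by linarith) (le_of_lt hy)
    rw [hev.fderiv_eq, fderiv_const_apply, norm_zero, zero_mul]
    positivity
  · calc ‖fderiv ℝ (radialCutoff R (2 * R) : (EuclideanSpace ℝ (Fin 3)) → ℝ) z‖ * ‖z‖ ≤ B * R⁻¹ * (2 * R) := by
          gcongr
          exact hB R hR z
      _ = 2 * B := by field_simp

/-- **Derivative bound for the high part**: `‖∇w_hi(y)‖ ≤ (1 + 2B) ‖∇w(y)‖` pointwise
(`∇w_hi = (1 − θ∘w) ∇w − (∇θ(w y) ∘ ∇w(y)) ⊗ w(y)` and `‖∇θ(z)‖ |z| ≤ 2B`). [folklore] -/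
theorem norm_fderiv_highPart_le (hw : ContDiff ℝ 1 w) {B : ℝ} (hB0 : 0 ≤ B)
    (hB : ∀ ε : ℝ, 0 < ε → ∀ z : (EuclideanSpace ℝ (Fin 3)), ‖fderiv ℝ (radialCutoff ε (2 * ε)) z‖ ≤ B * ε⁻¹)
    (hR : 0 < R) (y : (EuclideanSpace ℝ (Fin 3))) :
    ‖fderiv ℝ (fun y => (1 - radialCutoff R (2 * R) (w y)) • w y) y‖ ≤
      (1 + 2 * B) * ‖fderiv ℝ w y‖ := by
  have hθ : ContDiff ℝ 1 (radialCutoff R (2 * R) : (EuclideanSpace ℝ (Fin 3)) → ℝ) := radialCutoff_contDiff R (2 * R)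
  have hwd : DifferentiableAt ℝ w y := (hw.differentiable one_ne_zero) y
  have hθd : DifferentiableAt ℝ (radialCutoff R (2 * R) : (EuclideanSpace ℝ (Fin 3)) → ℝ) (w y) :=
    (hθ.differentiable one_ne_zero) _
  -- the derivative of the scalar factor
  have hcomp : HasFDerivAt (fun y => radialCutoff R (2 * R) (w y))
      ((fderiv ℝ (radialCutoff R (2 * R) : (EuclideanSpace ℝ (Fin 3)) → ℝ) (w y)).comp (fderiv ℝ w y)) y :=
    hθd.hasFDerivAt.comp y hwd.hasFDerivAt
  have hfac : HasFDerivAt (fun y => 1 - radialCutoff R (2 * R) (w y))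
      (-((fderiv ℝ (radialCutoff R (2 * R) : (EuclideanSpace ℝ (Fin 3)) → ℝ) (w y)).comp (fderiv ℝ w y))) y := by
    have h2 := (hasFDerivAt_const (1 : ℝ) y).fun_sub hcomp
    rwa [zero_sub] at h2
  have hprod := hfac.fun_smul hwd.hasFDerivAt
  rw [hprod.fderiv]
  have h0 : 0 ≤ 1 - radialCutoff R (2 * R) (w y) := sub_nonneg.2 (radialCutoff_le_one _ _ _)
  have h1 : 1 - radialCutoff R (2 * R) (w y) ≤ 1 := sub_le_self _ (radialCutoff_nonneg _ _ _)
  calc ‖(1 - radialCutoff R (2 * R) (w y)) • fderiv ℝ w y +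
          (-((fderiv ℝ (radialCutoff R (2 * R) : (EuclideanSpace ℝ (Fin 3)) → ℝ) (w y)).comp (fderiv ℝ w y))).smulRight (w y)‖
      ≤ ‖(1 - radialCutoff R (2 * R) (w y)) • fderiv ℝ w y‖ +
          ‖(-((fderiv ℝ (radialCutoff R (2 * R) : (EuclideanSpace ℝ (Fin 3)) → ℝ) (w y)).comp (fderiv ℝ w y))).smulRight (w y)‖ :=
        norm_add_le _ _
    _ ≤ 1 * ‖fderiv ℝ w y‖ +
          ‖fderiv ℝ (radialCutoff R (2 * R) : (EuclideanSpace ℝ (Fin 3)) → ℝ) (w y)‖ * ‖fderiv ℝ w y‖ * ‖w y‖ := by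
        gcongr
        · rw [norm_smul, Real.norm_eq_abs, abs_of_nonneg h0]
          exact mul_le_mul_of_nonneg_right h1 (norm_nonneg _)
        · rw [ContinuousLinearMap.norm_smulRight_apply, norm_neg]
          gcongr
          exact ContinuousLinearMap.opNorm_comp_le _ _
    _ = ‖fderiv ℝ w y‖ + (‖fderiv ℝ (radialCutoff R (2 * R) : (EuclideanSpace ℝ (Fin 3)) → ℝ) (w y)‖ * ‖w y‖) * ‖fderiv ℝ w y‖ := by
        ring
    _ ≤ ‖fderiv ℝ w y‖ + 2 * B * ‖fderiv ℝ w y‖ :=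
        add_le_add_right (mul_le_mul_of_nonneg_right
          (norm_fderiv_radialCutoff_mul_norm_le hB0 hB hR (w y)) (norm_nonneg _)) _
    _ = (1 + 2 * B) * ‖fderiv ℝ w y‖ := by ring

/-! ### Compact support -/

/-- **The high part has compact support when `w → 0` at infinity** (`R > 0`): `w_hi` vanishes
where `|w| ≤ R`, which holds off a large ball. [folklore] -/
theorem hasCompactSupport_highPart (hR : 0 < R) (hw0 : Tendsto w (cocompact (EuclideanSpace ℝ (Fin 3))) (𝓝 0)) :
    HasCompactSupport fun y => (1 - radialCutoff R (2 * R) (w y)) • w y := by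
  have hev : ∀ᶠ y in cocompact (EuclideanSpace ℝ (Fin 3)), ‖w y‖ < R := by
    have h := Metric.tendsto_nhds.1 hw0 R hR
    filter_upwards [h] with y hy
    simpa [dist_zero_right] using hy
  obtain ⟨t, ht, hts⟩ := mem_cocompact.1 hev
  obtain ⟨r, hr⟩ := ht.isBounded.subset_closedBall (0 : (EuclideanSpace ℝ (Fin 3)))
  refine HasCompactSupport.of_support_subset_isCompact (isCompact_closedBall (0 : (EuclideanSpace ℝ (Fin 3))) r) ?_
  intro y hy
  by_contra hyr
  have hyt : y ∈ tᶜ := fun h => hyr (hr h)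
  exact hy (highPart_eq_zero_of_norm_le hR (le_of_lt (hts hyt)))

end Splitting

end Literature.Analysis.FluidPDE

end
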